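import Summits.BirchSwinnertonDyer.BirchSwinnertonDyer.Theorems.ErratumRoadFiveSigmaLocalTotallySplit
import Summits.BirchSwinnertonDyer.BirchSwinnertonDyer.Theorems.ErratumRoadFiveSigmaLocalOfFinitelyDecomposed
import Literature.NumberTheory.EllipticCurves.JetchevSkinnerWan2017.SigmaLocalFinitelyDecomposedProofs
import Literature.NumberTheory.EllipticCurves.JetchevSkinnerWan2017.SigmaLocalAdditiveProofs
import HarnessLib

/-!
# The local `Σ`-atom (K2 support 20495 `JSWSigmaLocalCharIdeal`): conjuncts (1)–(2) at EVERY place,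
# unconditionally; conjunct (3) reduced to the Euler-factor identification at the finitely decomposed
# places of good ∕ multiplicative reduction

Cell `bsd-stepL`, K2 route `ErratumRoadFive`, support item 20495 `JSWSigmaLocalCharIdeal`
(= `JetchevSkinnerWan2017.sigmaLocal_charIdeal_eulerFactor_mem_of_noTamagawaDefect`), seat
`bsd-stepL-imc-p1` (g13). THEOREMS ONLY (no definition, no named fact, no `sorry`).

State of the atom after this file (three conjuncts at a place `w ∤ p` with Euler datum `(Nw, t, c)`:
(1) `X_w = H¹(K_w, T_pE ⊗ Λ^*(Ψ⁻¹))^∨` finitely generated over `Λ`, (2) `X_w` torsion, (3)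
`eulerFactor p ℤ_[p] Nw t c ∈ Ch_Λ(X_w)`):

* `moduleFinite_isTorsion_sigmaLocal` — **(1) and (2) hold at every place `w ∤ p`, for every elliptic `E`
  over any number field `K : Type`, every `ℤ_p`-extension, every reduction type — PROVED** (`c = 0`:
  `SigmaLocalTotallySplitProofs` + `finite_and_natCard_h1_primaryTorsion_local`; `c ≠ 0`:
  `JetchevSkinnerWan2017.sigmaLocal_moduleFinite_isTorsion_of_ne_zero`);
* (3) is PROVED at `c = 0` under `NoTamagawaDefect` (`sigmaLocal_of_isEulerDataAt_zero`) and at the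
  finitely decomposed ADDITIVE places (`sigmaLocal_additive_of_ne_zero`), and at every finitely decomposed
  place in the INTRINSIC form `P_w((1+T)^{−c}) ∈ Ch_Λ(X_w)`, `P_w = (charpoly of Frob_w on
  H¹(I_w, E[p^∞])^∨ ⧸ tors).reverse` (`sigmaLocal_dual_of_ne_zero`);
* `sigmaLocal_of_eulerFactor_mem_span_intrinsic` — **the atom follows from the single remaining
  identification (S5)**: at a finitely decomposed place of good or multiplicative reduction,
  `eulerFactor p ℤ_[p] Nw t c ∈ (P_w((1+T)^{−c}))` (expected: `P_w((1+T)^{−c}) = (Nw·u^{deg})⁻¹ · eulerFactor`,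
  `u = (1+T)^c`, from the Frobenius eigenvalues `α/q, β/q` on `T_p(E)(−1)` resp. `±1/q` on the toric line —
  [GreenbergVatsal2000] p. 22, [Skinner2016PacificMC] §2.3);
* `sigmaLocal_of_good_mult` — the same with (S5) replaced by conjunct (3) itself at those places.

References: [GreenbergVatsal2000] Prop. 2.4; [GreenbergLNM1716] §3; [Skinner2016PacificMC] §2.3 (p. 180);
[JetchevSkinnerWan2017] Thm. 3.3.1, proof of Thm. 6.1.6; [Castella2018] Thm. 2.3, Prop. 2.5.
-/

noncomputable section

open scoped Classical

open Field NumberField IsDedekindDomain WeierstrassCurve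
open Literature.NumberTheory.EllipticCurves Literature.NumberTheory.GaloisRepresentations
  Literature.NumberTheory.EllipticCurves.BigGaloisRep Literature.NumberTheory.EllipticCurves.IwasawaCharacter
  Literature.NumberTheory.EllipticCurves.JetchevSkinnerWan2017

set_option autoImplicit false
-- the Theorems namespace of this sub repeats the summit name by design (D-0017 nested layout)
set_option linter.dupNamespace false

namespace Summit.BirchSwinnertonDyer.BirchSwinnertonDyer.Theorems.SigmaLocal

/-- **Conjuncts (1) and (2) of the local `Σ`-atom at every place `w ∤ p`, unconditionally**: for `E`
elliptic over a number field `K : Type`, a prime `p`, a `ℤ_p`-extension `κ`, a finite place `w ∤ p` with an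
Euler datum `(Nw, t, c)` (any reduction type, any `c`), the Pontryagin dual of
`H¹(K_w, T_pE ⊗ Λ^*(Ψ⁻¹))` is a finitely generated torsion `Λ`-module.
[cite: GreenbergVatsal2000, Prop. 2.4] [cite: JetchevSkinnerWan2017, Thm. 3.3.1 (torsion of the local terms)]
[cite: GreenbergLNM1716, §3 Lemma 3.3] -/
theorem moduleFinite_isTorsion_sigmaLocal {K : Type} [Field K] [NumberField K]
    (E : WeierstrassCurve K) [E.IsElliptic] (p : ℕ) [Fact p.Prime] (κ : ZpExtension K p)
    (w : HeightOneSpectrum (𝓞 K)) (hw : ((p : ℕ) : 𝓞 K) ∉ w.asIdeal)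
    (Nw : ℕ) (t : LocalReductionData) (c : ℤ_[p]) (hdata : IsEulerDataAt E κ w Nw t c)
    [TopologicalSpace (IwasawaAlgebra p)]
    [ContinuousSMul (IwasawaAlgebra p) (BigRepModule ℤ_[p] p (PrimaryTorsion (geomPoints E) p))] :
    Module.Finite (IwasawaAlgebra p) (CharacterModule (continuousCohomology 1
        ((AnticyclotomicBigGaloisRep κ (E.primaryTorsionGaloisRep p)).restrict
          (localMap K (Sum.inl w))).toTopRep)) ∧
      Module.IsTorsion (IwasawaAlgebra p) (CharacterModule (continuousCohomology 1
        ((AnticyclotomicBigGaloisRep κ (E.primaryTorsionGaloisRep p)).restrict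
          (localMap K (Sum.inl w))).toTopRep)) := by
  haveI : ContinuousSMul ℤ_[p] (PrimaryTorsion (geomPoints E) p) := PrimaryTorsion.continuousSMul
  by_cases hc : c = 0
  · subst hc
    obtain ⟨hfin, -⟩ := finite_and_natCard_h1_primaryTorsion_local E p w hw
    haveI := hfin
    obtain ⟨hfg, htors, -⟩ :=
      moduleFinite_isTorsion_natCard_mem_charIdeal_of_isEulerDataAt_zero E p κ w hw Nw t hdata
    exact ⟨hfg, htors⟩
  · exact sigmaLocal_moduleFinite_isTorsion_of_ne_zero E p κ w hw Nw t c hdata hc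

/-- **The atom from conjunct (3) at the finitely decomposed good ∕ multiplicative places alone**:
`sigmaLocal_charIdeal_eulerFactor_mem_of_noTamagawaDefect` follows once `eulerFactor p ℤ_[p] Nw t c ∈ Ch_Λ(X_w)`
is known at the places with `c ≠ 0` and `t ≠ additive` (everything else is proved:
`sigmaLocal_of_finitelyDecomposed`, `moduleFinite_isTorsion_sigmaLocal`, `sigmaLocal_additive_of_ne_zero`).
[cite: JetchevSkinnerWan2017, proof of Thm. 6.1.6 (local display)] [cite: Skinner2016PacificMC, §2.3 (p. 180)] -/
theorem sigmaLocal_of_good_mult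
    (hGM : ∀ (W : WeierstrassCurve ℚ) [W.IsElliptic] (p : ℕ) [Fact p.Prime], 3 ≤ p →
      ∀ (K : Type) [Field K] [NumberField K], IsImaginaryQuadratic K →
      ∀ (κ : ZpExtension K p), κ.IsAnticyclotomic →
      ∀ (w : HeightOneSpectrum (𝓞 K)), ((p : ℕ) : 𝓞 K) ∉ w.asIdeal →
      ∀ (Nw : ℕ) (t : LocalReductionData) (c : ℤ_[p]),
        IsEulerDataAt (W.baseChange K) κ w Nw t c → c ≠ 0 → t ≠ .additive →
      ∀ [TopologicalSpace (IwasawaAlgebra p)]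
        [ContinuousSMul (IwasawaAlgebra p)
          (BigRepModule ℤ_[p] p (PrimaryTorsion (geomPoints (W.baseChange K)) p))],
        eulerFactor p ℤ_[p] Nw t c ∈ Module.charIdeal (IwasawaAlgebra p) (CharacterModule
          (continuousCohomology 1
            ((AnticyclotomicBigGaloisRep κ ((W.baseChange K).primaryTorsionGaloisRep p)).restrict
              (localMap K (Sum.inl w))).toTopRep))) :
    sigmaLocal_charIdeal_eulerFactor_mem_of_noTamagawaDefect := by
  refine sigmaLocal_of_finitelyDecomposed fun W _ p _ hp K _ _ hK κ hκ w hw Nw t c hdata hc _ _ => ?_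
  haveI : (W.baseChange K).IsElliptic := by rw [WeierstrassCurve.baseChange]; infer_instance
  haveI : ContinuousSMul ℤ_[p] (PrimaryTorsion (geomPoints (W.baseChange K)) p) :=
    PrimaryTorsion.continuousSMul
  obtain ⟨hfg, htors⟩ := moduleFinite_isTorsion_sigmaLocal (W.baseChange K) p κ w hw Nw t c hdata
  refine ⟨hfg, htors, ?_⟩
  by_cases ht : t = .additive
  · subst ht
    exact (sigmaLocal_additive_of_ne_zero (W.baseChange K) p κ w hw Nw c hdata hc).2.2
  · exact hGM W p hp K hK κ hκ w hw Nw t c hdata hc ht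

/-- **The atom from the Euler-factor identification (S5) alone**: if at every finitely decomposed place of
good or multiplicative reduction the tree's `eulerFactor p ℤ_[p] Nw t c` lies in the principal ideal of the
INTRINSIC factor `P_w((1+T)^{−c})`, `P_w = (charpoly Lt).reverse` for the endomorphism `Lt` of
`H¹(I_w, E[p^∞])^∨ ⧸ tors` induced by the Frobenius `φ` of the Euler datum, then
`sigmaLocal_charIdeal_eulerFactor_mem_of_noTamagawaDefect` holds (`Ch_Λ(X_w) ∋ P_w((1+T)^{−c})`,
`sigmaLocal_dual_of_ne_zero`). [cite: GreenbergVatsal2000, Prop. 2.4 (arXiv p. 22: 𝓟_ℓ = P_ℓ(ℓ⁻¹γ_ℓ))]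
[cite: Skinner2016PacificMC, §2.3 (p. 180)] -/
theorem sigmaLocal_of_eulerFactor_mem_span_intrinsic
    (hS5 : ∀ (W : WeierstrassCurve ℚ) [W.IsElliptic] (p : ℕ) [Fact p.Prime], 3 ≤ p →
      ∀ (K : Type) [Field K] [NumberField K], IsImaginaryQuadratic K →
      ∀ (κ : ZpExtension K p), κ.IsAnticyclotomic →
      ∀ (w : HeightOneSpectrum (𝓞 K)), ((p : ℕ) : 𝓞 K) ∉ w.asIdeal →
      ∀ (Nw : ℕ) (t : LocalReductionData) (c : ℤ_[p]),
        IsEulerDataAt (W.baseChange K) κ w Nw t c → c ≠ 0 → t ≠ .additive →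
      ∀ (φ : absoluteGaloisGroup (w.adicCompletion K)), IsFrobPow φ 1 →
        κ (localMap K (Sum.inl w) φ) = Multiplicative.ofAdd c →
      ∀ [ContinuousSMul ℤ_[p] (PrimaryTorsion (geomPoints (W.baseChange K)) p)]
        [Module.Finite ℤ_[p] (CharacterModule (continuousCohomology 1 (subgroupRep
          ((((W.baseChange K).primaryTorsionGaloisRep p).restrict (localMap K (Sum.inl w)) :
            ContinuousRep (absoluteGaloisGroup (w.adicCompletion K)) ℤ_[p]
              (PrimaryTorsion (geomPoints (W.baseChange K)) p))).toTopRep (absInertia (w.adicCompletion K)))))]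
        (Lt : (CharacterModule (continuousCohomology 1 (subgroupRep
            ((((W.baseChange K).primaryTorsionGaloisRep p).restrict (localMap K (Sum.inl w)) :
              ContinuousRep (absoluteGaloisGroup (w.adicCompletion K)) ℤ_[p]
                (PrimaryTorsion (geomPoints (W.baseChange K)) p))).toTopRep (absInertia (w.adicCompletion K)))) ⧸
            Submodule.torsion ℤ_[p] (CharacterModule (continuousCohomology 1 (subgroupRep
              ((((W.baseChange K).primaryTorsionGaloisRep p).restrict (localMap K (Sum.inl w)) :
                ContinuousRep (absoluteGaloisGroup (w.adicCompletion K)) ℤ_[p]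
                  (PrimaryTorsion (geomPoints (W.baseChange K)) p))).toTopRep
                (absInertia (w.adicCompletion K)))))) →ₗ[ℤ_[p]]
          (CharacterModule (continuousCohomology 1 (subgroupRep
            ((((W.baseChange K).primaryTorsionGaloisRep p).restrict (localMap K (Sum.inl w)) :
              ContinuousRep (absoluteGaloisGroup (w.adicCompletion K)) ℤ_[p]
                (PrimaryTorsion (geomPoints (W.baseChange K)) p))).toTopRep (absInertia (w.adicCompletion K)))) ⧸
            Submodule.torsion ℤ_[p] (CharacterModule (continuousCohomology 1 (subgroupRep
              ((((W.baseChange K).primaryTorsionGaloisRep p).restrict (localMap K (Sum.inl w)) :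
                ContinuousRep (absoluteGaloisGroup (w.adicCompletion K)) ℤ_[p]
                  (PrimaryTorsion (geomPoints (W.baseChange K)) p))).toTopRep
                (absInertia (w.adicCompletion K))))))),
        (∀ χ, Lt (Submodule.Quotient.mk χ) = Submodule.Quotient.mk
          (CharacterModule.dual (conjMap ((((W.baseChange K).primaryTorsionGaloisRep p).restrict
              (localMap K (Sum.inl w)) :
            ContinuousRep (absoluteGaloisGroup (w.adicCompletion K)) ℤ_[p]
              (PrimaryTorsion (geomPoints (W.baseChange K)) p))).toTopRep
            (absInertia (w.adicCompletion K)) φ 1).hom.toLinearMap χ)) →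
        eulerFactor p ℤ_[p] Nw t c ∈
          Ideal.span {Polynomial.aeval (BigRepModule.binomSeries ℤ_[p] (-c)) (LinearMap.charpoly Lt).reverse}) :
    sigmaLocal_charIdeal_eulerFactor_mem_of_noTamagawaDefect := by
  refine sigmaLocal_of_good_mult fun W _ p _ hp K _ _ hK κ hκ w hw Nw t c hdata hc ht _ _ => ?_
  haveI : (W.baseChange K).IsElliptic := by rw [WeierstrassCurve.baseChange]; infer_instance
  haveI : ContinuousSMul ℤ_[p] (PrimaryTorsion (geomPoints (W.baseChange K)) p) :=
    PrimaryTorsion.continuousSMul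
  obtain ⟨φ, hφ, hκφ⟩ := hdata.2.1
  haveI := moduleFinite_characterModule_h1_absInertia_primaryTorsion (W.baseChange K) p w hw
  obtain ⟨Lt, hLt⟩ := BigRepModule.exists_quotientTorsion_endo_dual
    (conjMap ((((W.baseChange K).primaryTorsionGaloisRep p).restrict (localMap K (Sum.inl w)) :
      ContinuousRep (absoluteGaloisGroup (w.adicCompletion K)) ℤ_[p]
        (PrimaryTorsion (geomPoints (W.baseChange K)) p))).toTopRep (absInertia (w.adicCompletion K)) φ 1).hom.toLinearMap
  obtain ⟨-, -, hCh⟩ := sigmaLocal_dual_of_ne_zero (W.baseChange K) p κ w hw hφ hκφ hc Lt hLt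
  have hle := (Ideal.span_singleton_le_iff_mem _).mpr hCh
  exact hle (hS5 W p hp K hK κ hκ w hw Nw t c hdata hc ht φ hφ hκφ Lt hLt)

end Summit.BirchSwinnertonDyer.BirchSwinnertonDyer.Theorems.SigmaLocal

end
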